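import Summits.AtomisticToContinuum.Crystallization.Theorems.FrustratedLawDichotomyStrainedPatchHomLeafTableCheckHcpV
import Summits.AtomisticToContinuum.Crystallization.Theorems.FrustratedLawDichotomyStrainedPatchHomLeafTableSums

/-!
# hcp vector-form leaf checker — the FOLD INVARIANT and the increments in `ℤ` (integer layer of the soundness proof)

decomp-a2c hand-2 g25 (crux `AperiodicFrustratedLawGap`, stmt-AtomisticToContinuum-27623; (H) hcp P-twin, critic rows 887/891/893).  Twin of
hand-2 g24's `…HomLeafTableFoldHcp` for the fold `foldV` of `…HomLeafTableCheckHcpV`: (i) failure is absorbing, so a passing leaf has every label either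
FAR-skipped or TREATED with a table row covering its range `[Q − R, Q + R]`; (ii) the accumulator of a passing fold is the fieldwise SUM of the per-label
increments `incrV`; (iii) the increment fields in closed integer form (ten signed classes, `sa = aD`, `sr = R`).  Small proof-side definitions
(`AccV.add`, `stepOKV`, `treatedV`, `incrV`, …); no analysis.  0 sorry; standard axioms.  `--supports stmt-AtomisticToContinuum-27623`.
-/

namespace Summit.AtomisticToContinuum.Crystallization.Theorems.FrustratedLawDichotomyStrainedPatchHomLeafTableCheckHcpV

open Summit.AtomisticToContinuum.Crystallization.Theorems.FrustratedLawDichotomyStrainedPatchHomLeafTableCheck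
  (Row QT sgnZ SCN addP addN sx absDiff addP_eq addN_eq addP_sub_addN sgnZ_mul sgnZ_sx natAbs_sgnZ)
open Summit.AtomisticToContinuum.Crystallization.Theorems.FrustratedLawDichotomyStrainedPatchHomLeafTableCheckHcp (NH)

/-! ## §1. Proof-side bookkeeping definitions -/

/-- Fieldwise sum of accumulators (`ok` conjoined). -/
def AccV.add (a c : AccV) : AccV :=
  ⟨a.ok && c.ok, a.vP + c.vP, a.vN + c.vN, a.dP + c.dP, a.dN + c.dN, a.sd + c.sd, a.g0P + c.g0P, a.g0N + c.g0N, a.g1P + c.g1P, a.g1N + c.g1N,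
   a.g2P + c.g2P, a.g2N + c.g2N, a.g3P + c.g3P, a.g3N + c.g3N, a.g4P + c.g4P, a.g4N + c.g4N, a.g5P + c.g5P, a.g5N + c.g5N,
   a.g6P + c.g6P, a.g6N + c.g6N, a.g7P + c.g7P, a.g7N + c.g7N, a.g8P + c.g8P, a.g8N + c.g8N, a.g9P + c.g9P, a.g9N + c.g9N, a.cur + c.cur,
   a.sa + c.sa, a.sr + c.sr⟩

/-- The label is FAR for this box: `81·SC ≤ 4·(Q − R)`. -/
def farBV (k : LV) (l : NH) : Bool := Nat.ble (Nat.mul 81 SCN) (Nat.mul 4 (QV k l - RV k l))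

/-- The row found for the label. -/
def rowOfV (tab : QT) (k : LV) (l : NH) : Option Row := QT.findLE (QV k l) tab none

/-- The range test of `step3V` for a row. -/
def rangeBV (k : LV) (l : NH) (row : Row) : Bool :=
  Nat.ble row.A (QV k l - RV k l) && Nat.ble (QV k l + RV k l) row.B && Nat.ble row.t (QV k l)

/-- The label passes the step without failure. -/
def stepOKV (tab : QT) (k : LV) (l : NH) : Bool :=
  Nat.ble (RV k l) (QV k l) && (farBV k l || match rowOfV tab k l with | none => false | some row => rangeBV k l row)

/-- The label is TREATED (not far, row found and in range). -/
def treatedV (tab : QT) (k : LV) (l : NH) : Bool :=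
  Nat.ble (RV k l) (QV k l) && !farBV k l && (match rowOfV tab k l with | none => false | some row => rangeBV k l row)

/-- The label's increment: its `step4V` on the empty accumulator (zero if not treated). -/
def incrV (tab : QT) (k : LV) (l : NH) : AccV :=
  match treatedV tab k l, rowOfV tab k l with
  | true, some row => step4V accV0 l (RV k l) row (QV k l - row.t)
  | _, _ => accV0

/-- The row of a label (junk `default`-free accessor: the zero row when none). -/
def rowTV (tab : QT) (k : LV) (l : NH) : Row :=
  match rowOfV tab k l with
  | some row => row
  | none => ⟨0, false, 0, false, 0, 0, 0, 0, 0⟩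

/-- `δ = Q − t` of a label (with its row `rowTV`). -/
def dltV (tab : QT) (k : LV) (l : NH) : ℕ := QV k l - (rowTV tab k l).t

/-! ## §2. Elementary facts about the step -/

/-- `step4V` is additive: it adds the label's increment to the accumulator. [formal bookkeeping] -/
theorem step4V_eq_add (a : AccV) (l : NH) (r : ℕ) (row : Row) (δ : ℕ) : step4V a l r row δ = a.add (step4V accV0 l r row δ) := by
  cases a
  simp only [step4V, AccV.add, accV0, Bool.and_true]
  congr 1 <;> first | rfl | (rw [addP_eq]) | (rw [addN_eq]) | simp [Nat.add_eq]

/-- Unfolding of the step into the proof-side predicates. [formal bookkeeping] -/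
theorem stepV_unfold (tab : QT) (k : LV) (a : AccV) (l : NH) :
    stepV tab k a l =
      (match Nat.ble (RV k l) (QV k l) with
        | true => (match farBV k l with
          | true => a
          | false => (match rowOfV tab k l with
            | none => a.fail
            | some row => (match rangeBV k l row with
              | true => step4V a l (RV k l) row (QV k l - row.t)
              | false => a.fail)))
        | false => a.fail) := by
  rfl

/-- A treated label adds its increment. [formal bookkeeping] -/
theorem stepV_of_treated {tab : QT} {k : LV} {l : NH} (h : treatedV tab k l = true) (a : AccV) : stepV tab k a l = a.add (incrV tab k l) := by
  rw [stepV_unfold]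
  unfold incrV
  rw [h]
  unfold treatedV at h
  cases h1 : Nat.ble (RV k l) (QV k l)
  · rw [h1] at h; simp at h
  · rw [h1] at h
    cases h2 : farBV k l
    · rw [h2] at h
      cases h3 : rowOfV tab k l with
      | none => rw [h3] at h; simp at h
      | some row =>
        rw [h3] at h
        simp only [Bool.true_and, Bool.not_false] at h
        simp only [h]
        exact step4V_eq_add a l (RV k l) row _
    · rw [h2] at h; simp at h

/-- A passing, untreated label is far-skipped: the accumulator is unchanged. [formal bookkeeping] -/
theorem stepV_of_far {tab : QT} {k : LV} {l : NH} (hs : stepOKV tab k l = true) (ht : treatedV tab k l = false) (a : AccV) :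
    stepV tab k a l = a := by
  rw [stepV_unfold]
  unfold stepOKV at hs
  unfold treatedV at ht
  cases h1 : Nat.ble (RV k l) (QV k l)
  · rw [h1] at hs; simp at hs
  · rw [h1] at hs ht
    cases h2 : farBV k l
    · rw [h2] at hs ht
      simp only [Bool.true_and, Bool.false_or, Bool.not_false] at hs ht
      cases h3 : rowOfV tab k l with
      | none => rw [h3] at hs; simp at hs
      | some row => rw [h3] at hs ht; simp only at hs ht; rw [hs] at ht; simp at ht
    · rfl

/-- A failing label sets `ok := false`. [formal bookkeeping] -/
theorem ok_stepV_of_not_stepOK {tab : QT} {k : LV} {l : NH} (hs : stepOKV tab k l = false) (a : AccV) : (stepV tab k a l).ok = false := by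
  rw [stepV_unfold]
  unfold stepOKV at hs
  cases h1 : Nat.ble (RV k l) (QV k l)
  · rfl
  · rw [h1] at hs
    cases h2 : farBV k l
    · rw [h2] at hs
      simp only [Bool.true_and, Bool.false_or] at hs
      cases h3 : rowOfV tab k l with
      | none => rfl
      | some row =>
        rw [h3] at hs; simp only at hs
        simp only [hs]
        rfl
    · rw [h2] at hs; simp at hs

/-- Failure is absorbing for one step. [formal bookkeeping] -/
theorem ok_stepV_of_fail {tab : QT} {k : LV} {a : AccV} {l : NH} (h : a.ok = false) : (stepV tab k a l).ok = false := by
  cases hs : stepOKV tab k l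
  · exact ok_stepV_of_not_stepOK hs a
  · cases ht : treatedV tab k l
    · rw [stepV_of_far hs ht]; exact h
    · rw [stepV_of_treated ht]; simp [AccV.add, h]

/-! ## §3. The fold -/

/-- `foldV` is the left fold of `stepV`. [formal bookkeeping] -/
theorem foldV_eq (tab : QT) (k : LV) : ∀ (ls : List NH) (a : AccV), foldV tab k a ls = ls.foldl (stepV tab k) a
  | [], _ => rfl
  | l :: ls, a => by unfold foldV; rw [List.foldl_cons]; exact foldV_eq tab k ls _

/-- Failure is absorbing for the fold. [formal bookkeeping] -/
theorem ok_foldlV_of_fail (tab : QT) (k : LV) : ∀ (ls : List NH) (a : AccV), a.ok = false → (ls.foldl (stepV tab k) a).ok = false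
  | [], _, h => h
  | _ :: ls, _, h => ok_foldlV_of_fail tab k ls _ (ok_stepV_of_fail h)

/-- ★ **THE FOLD INVARIANT.**  If the fold passes (`ok = true` at the end) then it started with `ok = true`, every label of the list passes its step, and
the final accumulator is the start plus the increments of the treated labels, added in order. [formal bookkeeping] -/
theorem foldl_stepV_eq (tab : QT) (k : LV) : ∀ (ls : List NH) (a : AccV), (ls.foldl (stepV tab k) a).ok = true →
    a.ok = true ∧ (∀ l ∈ ls, stepOKV tab k l = true) ∧
      ls.foldl (stepV tab k) a = (ls.filter (fun l => treatedV tab k l)).foldl (fun acc l => acc.add (incrV tab k l)) a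
  | [], a, h => ⟨h, fun _ hl => (List.not_mem_nil hl).elim, rfl⟩
  | l :: ls, a, h => by
    rw [List.foldl_cons] at h
    cases hs : stepOKV tab k l
    · have := ok_foldlV_of_fail tab k ls _ (ok_stepV_of_not_stepOK hs a)
      rw [h] at this; exact Bool.noConfusion this
    · obtain ⟨hok, hall, heq⟩ := foldl_stepV_eq tab k ls _ h
      refine ⟨?_, ?_, ?_⟩
      · cases ht : treatedV tab k l
        · rwa [stepV_of_far hs ht] at hok
        · rw [stepV_of_treated ht] at hok
          simp only [AccV.add, Bool.and_eq_true] at hok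
          exact hok.1
      · intro l' hl'
        rcases List.mem_cons.1 hl' with rfl | hmem
        · exact hs
        · exact hall l' hmem
      · rw [List.foldl_cons, List.filter_cons]
        cases ht : treatedV tab k l
        · simp only [Bool.false_eq_true, ite_false]
          rw [stepV_of_far hs ht] at heq ⊢; exact heq
        · simp only [ite_true, List.foldl_cons]
          rw [stepV_of_treated ht] at heq ⊢; exact heq

/-- Projections that are additive under `AccV.add` sum along the increment fold. [formal bookkeeping] -/
theorem proj_foldlV_add (π : AccV → ℕ) (hπ : ∀ a c, π (a.add c) = π a + π c) (f : NH → AccV) :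
    ∀ (ls : List NH) (a : AccV), π (ls.foldl (fun acc l => acc.add (f l)) a) = π a + (ls.map (fun l => π (f l))).sum
  | [], a => by simp
  | l :: ls, a => by rw [List.foldl_cons, proj_foldlV_add π hπ f ls, hπ, List.map_cons, List.sum_cons, Nat.add_assoc]

/-- A signed difference of two additive projections sums along the increment fold. [formal bookkeeping] -/
theorem proj_sub_foldlV_add (P N : AccV → ℕ) (hP : ∀ a c, P (a.add c) = P a + P c) (hN : ∀ a c, N (a.add c) = N a + N c)
    (f : NH → AccV) (ls : List NH) (a : AccV) :
    (P (ls.foldl (fun acc l => acc.add (f l)) a) : ℤ) - (N (ls.foldl (fun acc l => acc.add (f l)) a) : ℤ) =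
      (P a : ℤ) - (N a : ℤ) + ((ls.map (fun l => P (f l))).sum : ℤ) - ((ls.map (fun l => N (f l))).sum : ℤ) := by
  rw [proj_foldlV_add P hP f ls a, proj_foldlV_add N hN f ls a]
  push_cast
  ring

/-! ## §4. A treated label: its row, the range test, and the increment fields -/

/-- The row of a treated label exists and passes the range test. [formal bookkeeping] -/
theorem rowOfV_of_treated {tab : QT} {k : LV} {l : NH} (h : treatedV tab k l = true) :
    Nat.ble (RV k l) (QV k l) = true ∧ farBV k l = false ∧ ∃ row, rowOfV tab k l = some row ∧ rangeBV k l row = true := by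
  unfold treatedV at h
  simp only [Bool.and_eq_true, Bool.not_eq_true'] at h
  obtain ⟨⟨h1, h2⟩, h3⟩ := h
  refine ⟨h1, h2, ?_⟩
  cases hr : rowOfV tab k l with
  | none => rw [hr] at h3; exact Bool.noConfusion h3
  | some row => rw [hr] at h3; exact ⟨row, rfl, h3⟩

/-- For a treated label, `rowTV` is the row found. [formal bookkeeping] -/
theorem rowTV_eq_of_treated {tab : QT} {k : LV} {l : NH} (h : treatedV tab k l = true) : rowOfV tab k l = some (rowTV tab k l) := by
  obtain ⟨-, -, row, hr, -⟩ := rowOfV_of_treated h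
  unfold rowTV; rw [hr]

/-- A treated label's integer facts: `R ≤ Q`, not far, range `A ≤ Q − R`, `Q + R ≤ B`, `t ≤ Q` for its row. [formal bookkeeping] -/
theorem treatedV_facts {tab : QT} {k : LV} {l : NH} (h : treatedV tab k l = true) :
    RV k l ≤ QV k l ∧ ¬ (81 * SCN ≤ 4 * (QV k l - RV k l)) ∧ (rowTV tab k l).A ≤ QV k l - RV k l ∧ QV k l + RV k l ≤ (rowTV tab k l).B ∧
      (rowTV tab k l).t ≤ QV k l := by
  obtain ⟨h1, h2, row, hr, hrange⟩ := rowOfV_of_treated h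
  have hrow : rowTV tab k l = row := by unfold rowTV; rw [hr]
  rw [hrow]
  unfold rangeBV at hrange
  simp only [Bool.and_eq_true, Nat.ble_eq] at hrange
  unfold farBV at h2
  simp only [Nat.mul_eq, Bool.eq_false_iff, ne_eq, Nat.ble_eq] at h2
  exact ⟨Nat.le_of_ble_eq_true h1, h2, hrange.1.1, hrange.1.2, hrange.2⟩

/-- A passing untreated label is far: `R ≤ Q` and `81·SC ≤ 4·(Q − R)`. [formal bookkeeping] -/
theorem farBV_of_untreated {tab : QT} {k : LV} {l : NH} (hs : stepOKV tab k l = true) (ht : treatedV tab k l = false) :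
    RV k l ≤ QV k l ∧ 81 * SCN ≤ 4 * (QV k l - RV k l) := by
  unfold stepOKV at hs
  unfold treatedV at ht
  simp only [Bool.and_eq_true, Bool.or_eq_true] at hs
  obtain ⟨h1, h2⟩ := hs
  refine ⟨Nat.le_of_ble_eq_true h1, ?_⟩
  cases hf : farBV k l
  · rw [h1, hf] at ht
    simp only [Bool.not_false, Bool.true_and] at ht
    rw [hf] at h2
    simp only [Bool.false_eq_true, false_or] at h2
    cases hr : rowOfV tab k l with
    | none => rw [hr] at h2; exact Bool.noConfusion h2
    | some row => rw [hr] at h2 ht; rw [h2] at ht; exact Bool.noConfusion ht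
  · unfold farBV at hf
    simpa only [Nat.mul_eq, Nat.ble_eq] using hf

/-- The increment of a treated label with row `row`: its signed fields, `cur`, `sa`, `sr`. [formal bookkeeping] -/
theorem incrV_fields {tab : QT} {k : LV} {l : NH} {row : Row} (h : treatedV tab k l = true) (hr : rowOfV tab k l = some row) :
    (incrV tab k l).ok = true ∧
    (((incrV tab k l).vP : ℕ) : ℤ) - (incrV tab k l).vN = sgnZ row.sV row.aV ∧
    (((incrV tab k l).dP : ℕ) : ℤ) - (incrV tab k l).dN = sgnZ row.sD row.aD * ((QV k l - row.t : ℕ) : ℤ) ∧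
    (incrV tab k l).sd = QV k l - row.t ∧
    (((incrV tab k l).g0P : ℕ) : ℤ) - (incrV tab k l).g0N = sgnZ row.sD row.aD * (l.m00 : ℤ) ∧
    (((incrV tab k l).g1P : ℕ) : ℤ) - (incrV tab k l).g1N = sgnZ row.sD row.aD * (l.m11 : ℤ) ∧
    (((incrV tab k l).g2P : ℕ) : ℤ) - (incrV tab k l).g2N = sgnZ row.sD row.aD * (l.m22 : ℤ) ∧
    (((incrV tab k l).g3P : ℕ) : ℤ) - (incrV tab k l).g3N = sgnZ row.sD row.aD * sgnZ l.s01 l.m01 ∧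
    (((incrV tab k l).g4P : ℕ) : ℤ) - (incrV tab k l).g4N = sgnZ row.sD row.aD * sgnZ l.s02 l.m02 ∧
    (((incrV tab k l).g5P : ℕ) : ℤ) - (incrV tab k l).g5N = sgnZ row.sD row.aD * sgnZ l.s12 l.m12 ∧
    (((incrV tab k l).g6P : ℕ) : ℤ) - (incrV tab k l).g6N = sgnZ row.sD row.aD * sgnZ l.z0 l.a0 ∧
    (((incrV tab k l).g7P : ℕ) : ℤ) - (incrV tab k l).g7N = sgnZ row.sD row.aD * sgnZ l.z1 l.a1 ∧
    (((incrV tab k l).g8P : ℕ) : ℤ) - (incrV tab k l).g8N = sgnZ row.sD row.aD * sgnZ l.z2 l.a2 ∧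
    (((incrV tab k l).g9P : ℕ) : ℤ) - (incrV tab k l).g9N = sgnZ row.sD row.aD * (l.u : ℤ) ∧
    (incrV tab k l).cur = row.M * ((QV k l - row.t + RV k l) * (QV k l - row.t + RV k l)) ∧
    (incrV tab k l).sa = row.aD ∧ (incrV tab k l).sr = RV k l := by
  unfold incrV
  rw [h, hr]
  dsimp only [step4V, accV0]
  refine ⟨rfl, ?_, ?_, ?_, ?_, ?_, ?_, ?_, ?_, ?_, ?_, ?_, ?_, ?_, ?_, ?_, ?_⟩ <;> (try simp only [Nat.add_eq, Nat.mul_eq, Nat.zero_add])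
  · exact addP_sub_addN _ _
  · rw [addP_sub_addN, sgnZ_mul]
  · rw [addP_sub_addN, sgnZ_mul]
  · rw [addP_sub_addN, sgnZ_mul]
  · rw [addP_sub_addN, sgnZ_mul]
  · rw [addP_sub_addN, sgnZ_sx]
  · rw [addP_sub_addN, sgnZ_sx]
  · rw [addP_sub_addN, sgnZ_sx]
  · rw [addP_sub_addN, sgnZ_sx]
  · rw [addP_sub_addN, sgnZ_sx]
  · rw [addP_sub_addN, sgnZ_sx]
  · rw [addP_sub_addN, sgnZ_mul]

/-- Class magnitudes of an increment are `aD · |L|`. [formal bookkeeping] -/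
theorem incrV_gP_add_gN {tab : QT} {k : LV} {l : NH} {row : Row} (h : treatedV tab k l = true) (hr : rowOfV tab k l = some row) :
    (incrV tab k l).g0P + (incrV tab k l).g0N = row.aD * l.m00 ∧ (incrV tab k l).g1P + (incrV tab k l).g1N = row.aD * l.m11 ∧
    (incrV tab k l).g2P + (incrV tab k l).g2N = row.aD * l.m22 ∧ (incrV tab k l).g3P + (incrV tab k l).g3N = row.aD * l.m01 ∧
    (incrV tab k l).g4P + (incrV tab k l).g4N = row.aD * l.m02 ∧ (incrV tab k l).g5P + (incrV tab k l).g5N = row.aD * l.m12 ∧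
    (incrV tab k l).g6P + (incrV tab k l).g6N = row.aD * l.a0 ∧ (incrV tab k l).g7P + (incrV tab k l).g7N = row.aD * l.a1 ∧
    (incrV tab k l).g8P + (incrV tab k l).g8N = row.aD * l.a2 ∧ (incrV tab k l).g9P + (incrV tab k l).g9N = row.aD * l.u := by
  unfold incrV
  rw [h, hr]
  dsimp only [step4V, accV0]
  simp only [Nat.mul_eq]
  refine ⟨?_, ?_, ?_, ?_, ?_, ?_, ?_, ?_, ?_, ?_⟩
  · cases row.sD <;> simp [addP, addN]
  · cases row.sD <;> simp [addP, addN]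
  · cases row.sD <;> simp [addP, addN]
  · cases row.sD <;> cases l.s01 <;> simp [addP, addN, sx]
  · cases row.sD <;> cases l.s02 <;> simp [addP, addN, sx]
  · cases row.sD <;> cases l.s12 <;> simp [addP, addN, sx]
  · cases row.sD <;> cases l.z0 <;> simp [addP, addN, sx]
  · cases row.sD <;> cases l.z1 <;> simp [addP, addN, sx]
  · cases row.sD <;> cases l.z2 <;> simp [addP, addN, sx]
  · cases row.sD <;> simp [addP, addN]

/-- The value magnitudes of an increment: `vP + vN = aV`. [formal bookkeeping] -/
theorem incrV_vP_add_vN {tab : QT} {k : LV} {l : NH} {row : Row} (h : treatedV tab k l = true) (hr : rowOfV tab k l = some row) :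
    (incrV tab k l).vP + (incrV tab k l).vN = row.aV ∧ (incrV tab k l).dP + (incrV tab k l).dN = row.aD * (QV k l - row.t) := by
  unfold incrV
  rw [h, hr]
  dsimp only [step4V, accV0]
  simp only [Nat.mul_eq]
  refine ⟨?_, ?_⟩
  · cases row.sV <;> simp [addP, addN]
  · cases row.sD <;> simp [addP, addN]

end Summit.AtomisticToContinuum.Crystallization.Theorems.FrustratedLawDichotomyStrainedPatchHomLeafTableCheckHcpV
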